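import Summits.KontsevichZagierPeriods.KontsevichZagierPeriods.Theorems.LinRedNormalFormArrangementNormalFormSeparateThreeHHKLocal
import Summits.KontsevichZagierPeriods.KontsevichZagierPeriods.Theorems.LinRedNormalFormArrangementNormalFormSeparateThreeHHKFM
import Summits.KontsevichZagierPeriods.KontsevichZagierPeriods.Theorems.LinRedNormalFormArrangementNormalFormSeparateTwoMeas
import Summits.KontsevichZagierPeriods.KontsevichZagierPeriods.Theorems.LinRedNormalFormArrangementNormalFormSeparateTwoZeroWeights

/-!
# Termwise absolute convergence of the spatial Taylor split (`separateThree_hHk`)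

(Line `janus-bands`, crux `ArrangementNormalForm`, stub `stub_separateHigh`, part `HHKFinal`:
the wall-invariant termwise-split lemma `separateThree_hHk` in base dimension `3` with fibres.)
Base dimension `3` (`b = 2`: base `(x₀, x₁, y)`), `k` fibres. A terminal piece of the far-first
separation engine carries `P(x, y)/∏ L_j(x)^{e_j} · (y − ℓ(x))^{-n} · (fibre block)` on a bounded
`polyhedron × fibre cell`, absolutely convergent, with the wall invariant `hH` (an active
`x`-letter vanishes on the closed domain only on the pole plane, and then `n ≠ 0`). CLAIM: every
Taylor piece `q_i(x) (y − ℓ)^{i−n}/∏ L_j^{e_j} · (fibre block)` is absolutely integrable on the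
domain. Proof: the Tonelli dictionary (parts `Mass`, `Meas` of the planar case) reduces both the
hypothesis and the claim to base integrals against the fibre mass `lmass` over the EFFECTIVE base
polyhedron (Fourier–Motzkin, part `HHKFM`), on whose closure the wall invariant is available; the
claim is local on the compact closure, and the local theorem `SepHHK.local_finite3` of part
`HHKLocal` applies. Degenerate letters and an identically vanishing numerator make every piece
vanish identically.
-/

noncomputable section

open Set MeasureTheory Filter Topology
open scoped ENNReal

namespace Summit.KontsevichZagierPeriods.ArrangementNormalForm.JanusBands

open Literature.NumberTheory.Transcendental

namespace SepHHK

open SepTwo Literature.ModelTheory.ExponentialFields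

/-! ### Reading the literal base factors -/

/-- An `x`-form over a two-dimensional `x`. -/
theorem fin2_aff (c : (Fin 2 → ℚ) × ℚ) (x : Fin (2 + 1) → ℝ) :
    (∑ i, (c.1 i : ℝ) * x (Fin.castSucc i) + (c.2 : ℝ)) =
      (c.1 0 : ℝ) * x 0 + (c.1 1 : ℝ) * x 1 + c.2 := by
  rw [Fin.sum_univ_two]; rfl

/-- An `x`-form over a two-dimensional `x`, read on `ℝ^{3+k}`. -/
theorem fin2_affz {k : ℕ} (c : (Fin 2 → ℚ) × ℚ) (z : Fin (2 + 1 + k) → ℝ) :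
    (∑ i, (c.1 i : ℝ) * z (Fin.castAdd k (Fin.castSucc i)) + (c.2 : ℝ)) =
      (c.1 0 : ℝ) * basePt z 0 + (c.1 1 : ℝ) * basePt z 1 + c.2 := by
  rw [Fin.sum_univ_two]; rfl

/-- Rational coefficient polynomials evaluated at the `x`-part. -/
theorem aeval_eq_eval_pr2 (qi : MvPolynomial (Fin 2) ℚ) (x : Fin (2 + 1) → ℝ) :
    MvPolynomial.aeval (fun i => x (Fin.castSucc i)) qi =
      MvPolynomial.eval (pr2 x) (MvPolynomial.map (algebraMap ℚ ℝ) qi) := by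
  rw [MvPolynomial.eval_map, MvPolynomial.aeval_def]; rfl

/-- The literal base factor of the integrand in nice form. -/
theorem baseR_eq3 {m : ℕ} (L : Fin m → (Fin 2 → ℚ) × ℚ) (e : Fin m → ℕ)
    (p : MvPolynomial (Fin (2 + 1)) ℚ) (ℓ : (Fin 2 → ℚ) × ℚ) (n N : ℕ)
    (q : ℕ → MvPolynomial (Fin 2) ℚ)
    (hq : ∀ x : Fin (2 + 1) → ℝ, MvPolynomial.aeval x p = ∑ i ∈ Finset.range N,
      MvPolynomial.aeval (fun i => x (Fin.castSucc i)) (q i) *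
        (x (Fin.last 2) - (∑ i, (ℓ.1 i : ℝ) * x (Fin.castSucc i) + (ℓ.2 : ℝ))) ^ i)
    (x : Fin (2 + 1) → ℝ) :
    MvPolynomial.aeval x p / (∏ j, (∑ i, ((L j).1 i : ℝ) * x (Fin.castSucc i) + ((L j).2 : ℝ)) ^ e j) *
        (1 / (x (Fin.last 2) - (∑ i, (ℓ.1 i : ℝ) * x (Fin.castSucc i) + (ℓ.2 : ℝ))) ^ n) =
      (∑ i ∈ Finset.range N, MvPolynomial.eval (pr2 x) (MvPolynomial.map (algebraMap ℚ ℝ) (q i)) *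
        lam3 (ℓ.1 0) (ℓ.1 1) ℓ.2 x ^ i) /
        common (fun j i => ((L j).1 i : ℝ)) (fun j => ((L j).2 : ℝ)) e n (ℓ.1 0) (ℓ.1 1) ℓ.2 x := by
  rw [hq x]
  simp only [fin2_aff, aeval_eq_eval_pr2]
  rw [one_div, ← div_eq_mul_inv, div_div]
  rfl

/-- The literal base factor of a Taylor piece in nice form. -/
theorem baseRi_eq3 {m : ℕ} (L : Fin m → (Fin 2 → ℚ) × ℚ) (e : Fin m → ℕ) (ℓ : (Fin 2 → ℚ) × ℚ)
    (n : ℕ) (qi : MvPolynomial (Fin 2) ℚ) (i : ℕ) (x : Fin (2 + 1) → ℝ) :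
    MvPolynomial.aeval (fun i => x (Fin.castSucc i)) qi /
        (∏ j, (∑ i, ((L j).1 i : ℝ) * x (Fin.castSucc i) + ((L j).2 : ℝ)) ^ e j) *
        ((x (Fin.last 2) - (∑ i, (ℓ.1 i : ℝ) * x (Fin.castSucc i) + (ℓ.2 : ℝ))) ^ i /
          (x (Fin.last 2) - (∑ i, (ℓ.1 i : ℝ) * x (Fin.castSucc i) + (ℓ.2 : ℝ))) ^ n) =
      MvPolynomial.eval (pr2 x) (MvPolynomial.map (algebraMap ℚ ℝ) qi) * lam3 (ℓ.1 0) (ℓ.1 1) ℓ.2 x ^ i /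
        common (fun j i => ((L j).1 i : ℝ)) (fun j => ((L j).2 : ℝ)) e n (ℓ.1 0) (ℓ.1 1) ℓ.2 x := by
  simp only [fin2_aff, aeval_eq_eval_pr2]
  rw [div_mul_div_comm]
  rfl

/-- `x`-forms are measurable on the base. -/
theorem measurable_xform (c : (Fin 2 → ℚ) × ℚ) :
    Measurable fun x : Fin (2 + 1) → ℝ => ∑ i, (c.1 i : ℝ) * x (Fin.castSucc i) + (c.2 : ℝ) := by
  refine Measurable.add_const (Finset.measurable_sum _ fun i _ => ?_) _
  exact (measurable_pi_apply _).const_mul _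

/-- The literal base factor of the integrand is measurable. -/
theorem measurable_baseR3 {m : ℕ} (L : Fin m → (Fin 2 → ℚ) × ℚ) (e : Fin m → ℕ)
    (p : MvPolynomial (Fin (2 + 1)) ℚ) (ℓ : (Fin 2 → ℚ) × ℚ) (n : ℕ) :
    Measurable fun x : Fin (2 + 1) → ℝ => MvPolynomial.aeval x p /
      (∏ j, (∑ i, ((L j).1 i : ℝ) * x (Fin.castSucc i) + ((L j).2 : ℝ)) ^ e j) *
      (1 / (x (Fin.last 2) - (∑ i, (ℓ.1 i : ℝ) * x (Fin.castSucc i) + (ℓ.2 : ℝ))) ^ n) := by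
  refine ((measurable_aeval_real p).div ?_).mul ?_
  · exact Finset.measurable_prod _ fun j _ => (measurable_xform (L j)).pow_const _
  · exact Measurable.const_div (((measurable_pi_apply _).sub (measurable_xform ℓ)).pow_const _) _

/-- The literal base factor of a Taylor piece is measurable. -/
theorem measurable_baseRi3 {m : ℕ} (L : Fin m → (Fin 2 → ℚ) × ℚ) (e : Fin m → ℕ)
    (ℓ : (Fin 2 → ℚ) × ℚ) (n : ℕ) (qi : MvPolynomial (Fin 2) ℚ) (i : ℕ) :
    Measurable fun x : Fin (2 + 1) → ℝ => MvPolynomial.aeval (fun i => x (Fin.castSucc i)) qi /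
      (∏ j, (∑ i, ((L j).1 i : ℝ) * x (Fin.castSucc i) + ((L j).2 : ℝ)) ^ e j) *
      ((x (Fin.last 2) - (∑ i, (ℓ.1 i : ℝ) * x (Fin.castSucc i) + (ℓ.2 : ℝ))) ^ i /
        (x (Fin.last 2) - (∑ i, (ℓ.1 i : ℝ) * x (Fin.castSucc i) + (ℓ.2 : ℝ))) ^ n) := by
  have hlam : Measurable fun x : Fin (2 + 1) → ℝ =>
      x (Fin.last 2) - (∑ i, (ℓ.1 i : ℝ) * x (Fin.castSucc i) + (ℓ.2 : ℝ)) :=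
    (measurable_pi_apply _).sub (measurable_xform ℓ)
  refine (Measurable.div ?_ ?_).mul ((hlam.pow_const _).div (hlam.pow_const _))
  · exact (measurable_aeval_real qi).comp (measurable_pi_lambda _ fun i => measurable_pi_apply _)
  · exact Finset.measurable_prod _ fun j _ => (measurable_xform (L j)).pow_const _

/-- **An identically vanishing numerator has vanishing coefficient polynomials.** -/
theorem eval_eq_zero_of_num_zero (N : ℕ) (q : ℕ → MvPolynomial (Fin 2) ℝ) (l₁ l₂ l₀ : ℝ)
    (h : ∀ x : Fin 3 → ℝ, (∑ i ∈ Finset.range N, MvPolynomial.eval (pr2 x) (q i) *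
      lam3 l₁ l₂ l₀ x ^ i) = 0) (i : ℕ) (hi : i < N) (w : Fin 2 → ℝ) :
    MvPolynomial.eval w (q i) = 0 := by
  set hf : Fin (N + 1) → (Fin 2 → ℝ) → ℝ := fun i' w => if (i' : ℕ) < N then
    MvPolynomial.eval w (q i') else 0 with hhf
  have H : ∀ ξ : Fin 3 → ℝ, (∑ i' : Fin (N + 1), hf i' ![ξ 0, ξ 1] *
      (ξ 2 - (l₁ * ξ 0 + l₂ * ξ 1)) ^ (i' : ℕ)) = 0 := by
    intro ξ
    have hx := h ![ξ 0, ξ 1, ξ 2 + l₀]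
    have hpr : pr2 ![ξ 0, ξ 1, ξ 2 + l₀] = ![ξ 0, ξ 1] := by
      funext j; fin_cases j <;> rfl
    have hl : lam3 l₁ l₂ l₀ ![ξ 0, ξ 1, ξ 2 + l₀] = ξ 2 - (l₁ * ξ 0 + l₂ * ξ 1) := by
      show (ξ 2 + l₀) - (l₁ * ξ 0 + l₂ * ξ 1 + l₀) = _
      ring
    rw [hpr, hl, SepThree.sum_range_eq_sum_fin _ (Nat.le_succ N)] at hx
    rw [← hx]
    refine Finset.sum_congr rfl fun i' _ => ?_
    simp only [hhf]
    split_ifs <;> simp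
  have := lam_indep hf l₁ l₂ H ⟨i, Nat.lt_succ_of_lt hi⟩ w
  simpa [hhf, hi] using this

end SepHHK

/-! ### The stub -/

open SepTwo SepHHK in
/-- **Termwise absolute convergence of the spatial Taylor split under the wall invariant**
(`separateThree_hHk`, stub `stub_separateHigh` of the line `janus-bands`): see the module
docstring. -/
theorem separateThree_hHk (b k m m' n : ℕ) (s : KZ.IntegralRep (b + 1 + k)) (M : Fin m' → (Fin (b + 1) → ℚ) × ℚ) (L : Fin m → (Fin b → ℚ) × ℚ) (e : Fin m → ℕ) (p : MvPolynomial (Fin (b + 1)) ℚ) (ℓ : (Fin b → ℚ) × ℚ) (a : Fin k → Option ((Fin (b + 1) → ℚ) × ℚ)) (lo hi : Fin k → Fin k ⊕ ((Fin (b + 1) → ℚ) × ℚ)) (hpole : n ≠ 0 → ∀ z ∈ s.domain, (z (Fin.castAdd k (Fin.last b)) - (∑ i, (ℓ.1 i : ℝ) * z (Fin.castAdd k (Fin.castSucc i)) + (ℓ.2 : ℝ))) ≠ 0) (hbd : Bornology.IsBounded s.domain) (hdom : s.domain = {z | (∀ j, 0 < ∑ i, ((M j).1 i : ℝ) * z (Fin.castAdd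 k i) + ((M j).2 : ℝ)) ∧ ∀ i, Sum.elim (fun j => z (Fin.natAdd (b + 1) j)) (fun c => ∑ i', (c.1 i' : ℝ) * z (Fin.castAdd k i') + (c.2 : ℝ)) (lo i) < z (Fin.natAdd (b + 1) i) ∧ z (Fin.natAdd (b + 1) i) < Sum.elim (fun j => z (Fin.natAdd (b + 1) j)) (fun c => ∑ i', (c.1 i' : ℝ) * z (Fin.castAdd k i') + (c.2 : ℝ)) (hi i)}) (hint : EqOn s.integrand (fun z => MvPolynomial.aeval (fun i => z (Fin.castAdd k i)) p / (∏ j, (∑ i, ((L j).1 i : ℝ) * z (Fin.castAdd k (Fin.castSucc i)) + ((L j).2 : ℝ)) ^ e j) * (1 / (z (Fin.castAdd k (Fin.last b)) - (∑ i, (ℓ.1 i : ℝ) * z (Fin.castAdd k (Fin.castSucc i)) + (ℓ.2 : ℝ))) ^ n) * ∏ i, (a i).elim 1 (fun c => 1 / (z (Fin.natAdd (b + 1) i) - (∑ i', (c.1 i' : ℝ) * z (Fin.castAdd k i') + (c.2 : ℝ))))) s.domain) (N : ℕ) (q : ℕ → MvPolynomial (Fin b) ℚ) (hq : ∀ z :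 Fin (b + 1 + k) → ℝ, MvPolynomial.aeval (fun i => z (Fin.castAdd k i)) p = ∑ i ∈ Finset.range N, MvPolynomial.aeval (fun i => z (Fin.castAdd k (Fin.castSucc i))) (q i) * (z (Fin.castAdd k (Fin.last b)) - (∑ i, (ℓ.1 i : ℝ) * z (Fin.castAdd k (Fin.castSucc i)) + (ℓ.2 : ℝ))) ^ i) (hb : b = 2) (hH : ∀ j, e j ≠ 0 → ∀ z ∈ closure s.domain, (∑ i, ((L j).1 i : ℝ) * z (Fin.castAdd k (Fin.castSucc i)) + ((L j).2 : ℝ)) = 0 → (n ≠ 0 ∧ z (Fin.castAdd k (Fin.last b)) = ∑ i, (ℓ.1 i : ℝ) * z (Fin.castAdd k (Fin.castSucc i)) + (ℓ.2 : ℝ))) : ∀ i ∈ Finset.range N, IntegrableOn (fun z => MvPolynomial.aeval (fun i => z (Fin.castAdd k (Fin.castSucc i))) (q i) / (∏ j, (∑ i, ((L j).1 i : ℝ) * z (Fin.castAdd k (Fin.castSucc i)) + ((L j).2 : ℝ)) ^ e j) * ((z (Fin.castAdd k (Fin.last b)) - (∑ i, (ℓ.1 i : ℝ) * z (Fin.castAdd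 k (Fin.castSucc i)) + (ℓ.2 : ℝ))) ^ i / (z (Fin.castAdd k (Fin.last b)) - (∑ i, (ℓ.1 i : ℝ) * z (Fin.castAdd k (Fin.castSucc i)) + (ℓ.2 : ℝ))) ^ n) * ∏ i, (a i).elim 1 (fun c => 1 / (z (Fin.natAdd (b + 1) i) - (∑ i', (c.1 i' : ℝ) * z (Fin.castAdd k i') + (c.2 : ℝ))))) s.domain := by
  subst hb
  intro i hiN
  classical
  have _hp := hpole
  -- the vanishing case: a piece that is identically zero
  have hzero_case : (∀ z : Fin (2 + 1 + k) → ℝ,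
      MvPolynomial.aeval (fun i => z (Fin.castAdd k (Fin.castSucc i))) (q i) /
        (∏ j, (∑ i, ((L j).1 i : ℝ) * z (Fin.castAdd k (Fin.castSucc i)) + ((L j).2 : ℝ)) ^ e j) = 0) →
      IntegrableOn (fun z : Fin (2 + 1 + k) → ℝ =>
        MvPolynomial.aeval (fun i => z (Fin.castAdd k (Fin.castSucc i))) (q i) /
        (∏ j, (∑ i, ((L j).1 i : ℝ) * z (Fin.castAdd k (Fin.castSucc i)) + ((L j).2 : ℝ)) ^ e j) *
        ((z (Fin.castAdd k (Fin.last 2)) - (∑ i, (ℓ.1 i : ℝ) * z (Fin.castAdd k (Fin.castSucc i)) + (ℓ.2 : ℝ))) ^ i /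
          (z (Fin.castAdd k (Fin.last 2)) - (∑ i, (ℓ.1 i : ℝ) * z (Fin.castAdd k (Fin.castSucc i)) + (ℓ.2 : ℝ))) ^ n) *
        ∏ i, (a i).elim 1 (fun c => 1 / (z (Fin.natAdd (2 + 1) i) -
          (∑ i', (c.1 i' : ℝ) * z (Fin.castAdd k i') + (c.2 : ℝ))))) s.domain := by
    intro h0
    have hf0 : (fun z : Fin (2 + 1 + k) → ℝ =>
        MvPolynomial.aeval (fun i => z (Fin.castAdd k (Fin.castSucc i))) (q i) /
        (∏ j, (∑ i, ((L j).1 i : ℝ) * z (Fin.castAdd k (Fin.castSucc i)) + ((L j).2 : ℝ)) ^ e j) *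
        ((z (Fin.castAdd k (Fin.last 2)) - (∑ i, (ℓ.1 i : ℝ) * z (Fin.castAdd k (Fin.castSucc i)) + (ℓ.2 : ℝ))) ^ i /
          (z (Fin.castAdd k (Fin.last 2)) - (∑ i, (ℓ.1 i : ℝ) * z (Fin.castAdd k (Fin.castSucc i)) + (ℓ.2 : ℝ))) ^ n) *
        ∏ i, (a i).elim 1 (fun c => 1 / (z (Fin.natAdd (2 + 1) i) -
          (∑ i', (c.1 i' : ℝ) * z (Fin.castAdd k i') + (c.2 : ℝ))))) = fun _ => 0 := by
      funext z; rw [h0 z, zero_mul, zero_mul]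
    rw [hf0]
    exact integrableOn_zero
  -- degenerate letters: an active letter that is identically zero kills every piece
  by_cases hdeg : ∃ j, e j ≠ 0 ∧ (L j).1 = 0 ∧ (L j).2 = 0
  · obtain ⟨j, hej, h1, h2⟩ := hdeg
    refine hzero_case fun z => ?_
    rw [Finset.prod_eq_zero (Finset.mem_univ j) (by rw [h1, h2]; simp [hej]), div_zero]
  push Not at hdeg
  -- the real data
  set κ : Fin m → Fin 2 → ℝ := fun j i => ((L j).1 i : ℝ) with hκ
  set μ : Fin m → ℝ := fun j => ((L j).2 : ℝ) with hμ
  set qR : ℕ → MvPolynomial (Fin 2) ℝ := fun i => MvPolynomial.map (algebraMap ℚ ℝ) (q i) with hqR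
  have hκ0 : ∀ j, e j ≠ 0 → κ j = 0 → μ j ≠ 0 := by
    intro j hej hk0 hμ0
    have hμ0' : ((L j).2 : ℝ) = 0 := hμ0
    refine hdeg j hej ?_ (by exact_mod_cast hμ0')
    funext i'
    have h : ((L j).1 i' : ℝ) = 0 := congr_fun hk0 i'
    rw [Pi.zero_apply]
    exact_mod_cast h
  -- the base sets: the literal base and the effective base
  set Y₀ : Set (Fin (2 + 1) → ℝ) := {x | ∀ j, 0 < av x (M j)} with hY₀
  have hdom₀ : s.domain = fdom Y₀ lo hi := hdom
  obtain ⟨m'', φ, hφ⟩ := exists_eff_forms M lo hi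
  set Y : Set (Fin (2 + 1) → ℝ) := {x | ∀ j, 0 < rav x (φ j)} with hY
  have hYeq : Y₀ ∩ {x | (cell lo hi (av x)).Nonempty} = Y := by
    ext x; exact hφ x
  have hdom' : s.domain = fdom Y lo hi := by rw [hdom₀, fdom_eq_eff, hYeq]
  have hYm : MeasurableSet Y := measurableSet_Y3 φ
  have hYimg : basePt '' s.domain = Y := by rw [hdom₀, basePt_image_fdom, hYeq]
  -- the literal base factors in nice form
  have hqx : ∀ x : Fin (2 + 1) → ℝ, MvPolynomial.aeval x p = ∑ i ∈ Finset.range N,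
      MvPolynomial.aeval (fun i => x (Fin.castSucc i)) (q i) *
        (x (Fin.last 2) - (∑ i, (ℓ.1 i : ℝ) * x (Fin.castSucc i) + (ℓ.2 : ℝ))) ^ i := by
    intro x
    have h := hq (Fin.append x 0)
    simpa only [Fin.append_left] using h
  set R : (Fin (2 + 1) → ℝ) → ℝ := fun x => MvPolynomial.aeval x p /
    (∏ j, (∑ i, ((L j).1 i : ℝ) * x (Fin.castSucc i) + ((L j).2 : ℝ)) ^ e j) *
    (1 / (x (Fin.last 2) - (∑ i, (ℓ.1 i : ℝ) * x (Fin.castSucc i) + (ℓ.2 : ℝ))) ^ n) with hRdef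
  set Ri : ℕ → (Fin (2 + 1) → ℝ) → ℝ := fun i x => MvPolynomial.aeval (fun i => x (Fin.castSucc i)) (q i) /
    (∏ j, (∑ i, ((L j).1 i : ℝ) * x (Fin.castSucc i) + ((L j).2 : ℝ)) ^ e j) *
    ((x (Fin.last 2) - (∑ i, (ℓ.1 i : ℝ) * x (Fin.castSucc i) + (ℓ.2 : ℝ))) ^ i /
      (x (Fin.last 2) - (∑ i, (ℓ.1 i : ℝ) * x (Fin.castSucc i) + (ℓ.2 : ℝ))) ^ n) with hRidef
  have hR' : ∀ x, R x = (∑ i ∈ Finset.range N, MvPolynomial.eval (pr2 x) (qR i) *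
      lam3 (ℓ.1 0) (ℓ.1 1) ℓ.2 x ^ i) / common κ μ e n (ℓ.1 0) (ℓ.1 1) ℓ.2 x :=
    fun x => baseR_eq3 L e p ℓ n N q hqx x
  have hRi' : ∀ i < N, ∀ x, Ri i x = MvPolynomial.eval (pr2 x) (qR i) * lam3 (ℓ.1 0) (ℓ.1 1) ℓ.2 x ^ i /
      common κ μ e n (ℓ.1 0) (ℓ.1 1) ℓ.2 x := fun i _ x => baseRi_eq3 L e ℓ n (q i) i x
  have hRm : Measurable R := measurable_baseR3 L e p ℓ n
  have hRim : ∀ i, Measurable (Ri i) := fun i => measurable_baseRi3 L e ℓ n (q i) i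
  -- the global finiteness of the integrand over the base
  have hfinY : ∫⁻ x in Y, ENNReal.ofReal |R x| * lmass lo hi a (av x) < ∞ := by
    have hI := s.integrableOn
    rw [hdom'] at hI
    have hint' : EqOn s.integrand (fun z => R (basePt z) * rblock a z) (fdom Y lo hi) := by
      intro z hz
      rw [← hdom'] at hz
      rw [hint hz]
      rfl
    exact (integrableOn_fdom_iff hYm lo hi a _ hRm s.integrand hint' hI.aestronglyMeasurable).1 hI
  -- the wall invariant on the closure of the effective base
  have hH' : ∀ j, e j ≠ 0 → ∀ x ∈ closure Y, lval3 κ μ j x = 0 →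
      n ≠ 0 ∧ lam3 (ℓ.1 0) (ℓ.1 1) ℓ.2 x = 0 := by
    intro j hej x hx hL
    rw [← hYimg] at hx
    obtain ⟨z, hz, rfl⟩ := closure_image_basePt_subset hbd hx
    have h := hH j hej z hz (by rw [fin2_affz]; exact hL)
    rw [fin2_affz] at h
    exact ⟨h.1, sub_eq_zero.2 h.2⟩
  -- an identically vanishing numerator
  by_cases hnz : ∃ x₀ : Fin 3 → ℝ, (∑ i ∈ Finset.range N, MvPolynomial.eval (pr2 x₀) (qR i) *
      lam3 (ℓ.1 0) (ℓ.1 1) ℓ.2 x₀ ^ i) ≠ 0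
  swap
  · push Not at hnz
    have hiN' : i < N := Finset.mem_range.1 hiN
    refine hzero_case fun z => ?_
    have h0 : MvPolynomial.aeval (fun i => z (Fin.castAdd k (Fin.castSucc i))) (q i) = 0 := by
      have h := eval_eq_zero_of_num_zero N qR _ _ _ hnz i hiN' (pr2 (basePt z))
      rw [← aeval_eq_eval_pr2] at h
      exact h
    rw [h0, zero_div]
  -- local + compact
  refine SepTwoZero.integrableOn_of_forall_nhds hbd.isCompact_closure fun z₀ hz₀ => ?_
  have hcb : Continuous (basePt : (Fin (2 + 1 + k) → ℝ) → Fin (2 + 1) → ℝ) :=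
    continuous_pi fun i => continuous_apply _
  have hb₀ : basePt z₀ ∈ closure Y := by
    rw [← hYimg]
    exact image_closure_subset_closure_image hcb ⟨z₀, hz₀, rfl⟩
  obtain ⟨V, hVo, hVx, hVfin⟩ := local_finite3 φ lo hi a κ μ e n (ℓ.1 0) (ℓ.1 1) ℓ.2 N qR R Ri
    hR' hRi' hRm hRim hfinY hκ0 hH' hnz (basePt z₀) hb₀
  refine ⟨basePt ⁻¹' V, hVo.preimage hcb, hVx, ?_⟩
  have hset : s.domain ∩ basePt ⁻¹' V = fdom (Y ∩ V) lo hi := by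
    rw [hdom']
    ext z
    simp only [fdom, mem_inter_iff, mem_setOf_eq, mem_preimage]
    tauto
  rw [hset]
  refine integrableOn_of_lintegral_lt_top (hYm.inter hVo.measurableSet) lo hi a (hRim i)
    (fun z _ => rfl) ?_
  calc ∫⁻ x in Y ∩ V, ENNReal.ofReal |Ri i x| * lmass lo hi a (av x)
      ≤ ∫⁻ x in Y ∩ V, Y.indicator (fun x => (∑ i' ∈ Finset.range N, ENNReal.ofReal |Ri i' x|) *
          lmass lo hi a (av x)) x := by
        refine setLIntegral_mono' (hYm.inter hVo.measurableSet) fun x hx => ?_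
        rw [indicator_of_mem hx.1]
        exact mul_le_mul_left (Finset.single_le_sum (f := fun i' => ENNReal.ofReal |Ri i' x|)
          (fun _ _ => zero_le) hiN) _
    _ ≤ _ := lintegral_mono_set inter_subset_right
    _ < ∞ := hVfin

end Summit.KontsevichZagierPeriods.ArrangementNormalForm.JanusBands
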